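import Summits.Ventures.YMGap.FlowData.RectTubeMagneticTwistFlatness
import Summits.Ventures.YMGap.FlowData.RectTubeKernelNearIdentity
import Literature.Barriers.CriticalPhenomena.RigorousRGSmallParameterHHWReduction
import Literature.Barriers.AtomisticToContinuum.DisorderedHarmonicChainPhasesProofs
import HarnessLib

/-!
# Venture YMGap, track Y3 FLOW-DATA — second-order Taylor data of the (twisted) rectangular-tube slice kernel
# `K_ζ(a,b) = ∫ exp(J Φ_ζ(a,E,b)) dE` and the real-arithmetic core of the second-order law of `ln λ₀` (theorems only)

HONEST FRAMING: venture file of the cell `pub-ymgap` (QuantumFields programme), track Y3 (FLOW-DATA); companion THEOREMS for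
`FlowData/RectTubeMagneticTwistFlatness.lean` (twisted slice kernel `rectSliceKernelTw`) and `FlowData/RectTubeKernelNearIdentity.lean`.
Finite rectangular tube `Π ℤ/Lᵢ`, compact `G`, continuous unitary `ρ`, ANY plaquette field `ζ` (`ζ ≡ 1` = untwisted); the exponent
of one time step is `Φ_ζ(a, E, b) = ½ magTw_ζ(a) + ½ magTw_ζ(b) + elec(a, E, b)` with `|Φ_ζ| ≤ c := n(3#P + N)`:

* `rectSliceKernelTw_eq_integral_exp` — `K_ζ(a,b) = ∫_E exp(J Φ_ζ)`; `abs_rectElecSum_le`, `abs_stepExponent_le` — `|Φ_ζ| ≤ c`;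
* `abs_rectSliceKernelTw_taylor_le` — `|K_ζ(a,b) − 1 − J φ₁ − (J²/2) φ₂| ≤ (|J| c)³` with `φ₁ = ∫_E Φ_ζ`, `φ₂ = ∫_E Φ_ζ²`, `|J| c ≤ 1`;
* `abs_log_sub_secondOrder_le` — the real-arithmetic heart of the law `ln λ₀ = J m₁ + (J²/2)(m₂ − m₁²) + J² V + O(|J|³ c³)`.

(The elementary remainders `|eˣ − 1 − x − x²/2| ≤ |x|³`, `|log(1+x) − x + x²/2| ≤ 2|x|³` are the tree's
`HierarchicalRG.abs_exp_sub_le` / `HeatConduction.abs_log_one_add_sub_le`.)  Used by `FlowData/RectTubeLogNormSecondOrder.lean`.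
Nothing about `L → ∞`, the continuum or a mass gap; no FLOW-TABLE number.

References: I. Montvay, G. Münster (1994) §3.2.6 [cite: MontvayMunster1994, §3.2.6]; T. Kato (1966) §II.2 [cite: Kato1966, §II.2].
-/

noncomputable section

open scoped BigOperators ENNReal InnerProductSpace
open MeasureTheory Filter Function Topology Finset
open Literature.MathematicalPhysics.QuantumFieldTheory Literature.Analysis.OperatorTheory
open Literature.MathematicalPhysics.QuantumLattice (RectTorusSite)
open Literature.Barriers.QuantumFields
open Summit.Ventures.YMGap.Census (RectPlaquette)

namespace Summit.Ventures.YMGap.FlowData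

section KernelTaylor

variable {G : Type*} [Group G] [TopologicalSpace G] [IsTopologicalGroup G] [CompactSpace G]
  [MeasurableSpace G] [BorelSpace G] [SecondCountableTopology G] {n k : ℕ} (ρ : G →* Matrix (Fin n) (Fin n) ℂ)
  (J : ℝ) {Ls : Fin k → ℕ} [∀ i, NeZero (Ls i)]

omit [SecondCountableTopology G] in
/-- **`K_ζ(a, b) = ∫ exp(J Φ_ζ(a, E, b)) dE`** with the one-step exponent `Φ_ζ = ½ magTw_ζ(a) + ½ magTw_ζ(b) + elec(a,E,b)`.
[cite: MontvayMunster1994, §3.2.6] -/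
theorem rectSliceKernelTw_eq_integral_exp (ζ : RectPlaquette Ls → G) (a b : RectSlice Ls G) :
    rectSliceKernelTw (Ls := Ls) ρ ζ J J a b =
      ∫ E, Real.exp (J * (rectMagSumTw ρ ζ a / 2 + rectMagSumTw ρ ζ b / 2 + rectElecSum ρ a E b))
        ∂(Measure.pi fun _ : RectTorusSite Ls => haarProbability G) := by
  unfold rectSliceKernelTw
  rw [← integral_const_mul, ← integral_mul_const]
  refine integral_congr_ae (ae_of_all _ fun E => ?_)
  beta_reduce
  rw [← Real.exp_add, ← Real.exp_add]
  congr 1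
  ring

omit [TopologicalSpace G] [IsTopologicalGroup G] [CompactSpace G] [MeasurableSpace G] [BorelSpace G]
  [SecondCountableTopology G] in
/-- `|elec(a, E, b)| ≤ n · N` (`N = #sites · k` temporal plaquettes; unitary `ρ`). [folklore] -/
theorem abs_rectElecSum_le (hρu : ∀ g, ρ g ∈ Matrix.unitaryGroup (Fin n) ℂ) (a : RectSlice Ls G)
    (E : RectTorusSite Ls → G) (b : RectSlice Ls G) :
    |rectElecSum (Ls := Ls) ρ a E b| ≤ n * Fintype.card (RectTorusSite Ls × Fin k) := by
  have htr : ∀ g : G, |(ρ g).trace.re| ≤ n := fun g =>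
    (Complex.abs_re_le_norm _).trans (FiniteTemperature.norm_trace_le_of_mem_unitaryGroup (hρu _))
  unfold rectElecSum
  refine (Finset.abs_sum_le_sum_abs _ _).trans ?_
  refine (Finset.sum_le_sum fun x _ => (Finset.abs_sum_le_sum_abs _ _).trans
    (Finset.sum_le_sum fun i _ => htr _)).trans (le_of_eq ?_)
  simp only [Finset.sum_const, Finset.card_univ, Fintype.card_prod]
  push_cast
  ring

omit [TopologicalSpace G] [IsTopologicalGroup G] [CompactSpace G] [MeasurableSpace G] [BorelSpace G]
  [SecondCountableTopology G] in
/-- **`|Φ_ζ(a, E, b)| ≤ c := n (3#P + N)`** (crude: `|magTw| ≤ n#P` twice, `|elec| ≤ nN`). [folklore] -/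
theorem abs_stepExponent_le (hρu : ∀ g, ρ g ∈ Matrix.unitaryGroup (Fin n) ℂ) (ζ : RectPlaquette Ls → G)
    (a : RectSlice Ls G) (E : RectTorusSite Ls → G) (b : RectSlice Ls G) :
    |rectMagSumTw ρ ζ a / 2 + rectMagSumTw ρ ζ b / 2 + rectElecSum ρ a E b| ≤
      n * (3 * (Fintype.card (RectTorusSite Ls) * Fintype.card {p : Fin k × Fin k // p.1 < p.2}) +
        Fintype.card (RectTorusSite Ls × Fin k)) := by
  have ha := abs_rectMagSumTw_le ρ (Ls := Ls) hρu ζ a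
  have hb := abs_rectMagSumTw_le ρ (Ls := Ls) hρu ζ b
  have he := abs_rectElecSum_le ρ (Ls := Ls) hρu a E b
  have hP0 : (0 : ℝ) ≤ n * (Fintype.card (RectTorusSite Ls) * Fintype.card {p : Fin k × Fin k // p.1 < p.2}) := by
    positivity
  calc |rectMagSumTw ρ ζ a / 2 + rectMagSumTw ρ ζ b / 2 + rectElecSum ρ a E b|
      ≤ |rectMagSumTw ρ ζ a / 2| + |rectMagSumTw ρ ζ b / 2| + |rectElecSum ρ a E b| :=
        (abs_add_le _ _).trans (add_le_add ((abs_add_le _ _)) le_rfl)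
    _ ≤ n * (3 * (Fintype.card (RectTorusSite Ls) * Fintype.card {p : Fin k × Fin k // p.1 < p.2}) +
        Fintype.card (RectTorusSite Ls × Fin k)) := by
        rw [abs_div, abs_div, abs_two]
        nlinarith

/-- **Second-order Taylor expansion of the twisted slice kernel**: for `|J| c ≤ 1`,
`|K_ζ(a,b) − 1 − J φ₁(a,b) − (J²/2) φ₂(a,b)| ≤ (|J| c)³` with `φ₁ = ∫_E Φ_ζ`, `φ₂ = ∫_E Φ_ζ²`. [cite: Kato1966, §II.2] -/
theorem abs_rectSliceKernelTw_taylor_le (hρ : Continuous ρ) (hρu : ∀ g, ρ g ∈ Matrix.unitaryGroup (Fin n) ℂ)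
    (ζ : RectPlaquette Ls → G)
    (hJ : |J| * (n * (3 * (Fintype.card (RectTorusSite Ls) * Fintype.card {p : Fin k × Fin k // p.1 < p.2}) +
        Fintype.card (RectTorusSite Ls × Fin k))) ≤ 1) (a b : RectSlice Ls G) :
    |rectSliceKernelTw (Ls := Ls) ρ ζ J J a b - 1 -
        J * (∫ E, (rectMagSumTw ρ ζ a / 2 + rectMagSumTw ρ ζ b / 2 + rectElecSum ρ a E b)
          ∂(Measure.pi fun _ : RectTorusSite Ls => haarProbability G)) -
        J ^ 2 / 2 * (∫ E, (rectMagSumTw ρ ζ a / 2 + rectMagSumTw ρ ζ b / 2 + rectElecSum ρ a E b) ^ 2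
          ∂(Measure.pi fun _ : RectTorusSite Ls => haarProbability G))| ≤
      (|J| * (n * (3 * (Fintype.card (RectTorusSite Ls) * Fintype.card {p : Fin k × Fin k // p.1 < p.2}) +
        Fintype.card (RectTorusSite Ls × Fin k)))) ^ 3 := by
  set c : ℝ := n * (3 * (Fintype.card (RectTorusSite Ls) * Fintype.card {p : Fin k × Fin k // p.1 < p.2}) +
        Fintype.card (RectTorusSite Ls × Fin k)) with hc
  set μE : Measure (RectTorusSite Ls → G) := Measure.pi fun _ : RectTorusSite Ls => haarProbability G with hμE
  set Φ : (RectTorusSite Ls → G) → ℝ := fun E => rectMagSumTw ρ ζ a / 2 + rectMagSumTw ρ ζ b / 2 + rectElecSum ρ a E b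
    with hΦ
  have hΦb : ∀ E, |Φ E| ≤ c := fun E => abs_stepExponent_le ρ (Ls := Ls) hρu ζ a E b
  have hc0 : 0 ≤ c := by positivity
  -- continuity / integrability in `E`
  have hel : Continuous fun E : RectTorusSite Ls → G => rectElecSum ρ a E b := by
    have htr : Continuous fun g : G => (ρ g).trace.re := Complex.continuous_re.comp (Continuous.matrix_trace hρ)
    unfold rectElecSum
    refine continuous_finsetSum _ fun x _ => continuous_finsetSum _ fun i _ => htr.comp ?_
    exact (((continuous_apply x).mul continuous_const).mul (continuous_apply (x + Pi.single i 1)).inv).mul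
      continuous_const
  have hΦc : Continuous Φ := continuous_const.add hel
  have hint : ∀ {f : (RectTorusSite Ls → G) → ℝ}, Continuous f → Integrable f μE := fun hf =>
    hf.integrable_of_hasCompactSupport (HasCompactSupport.of_compactSpace _)
  have iexp : Integrable (fun E => Real.exp (J * Φ E)) μE := hint ((continuous_const.mul hΦc).rexp)
  have i1 : Integrable Φ μE := hint hΦc
  have i2 : Integrable (fun E => Φ E ^ 2) μE := hint (hΦc.pow 2)
  -- pointwise Taylor
  have hpt : ∀ E, |Real.exp (J * Φ E) - 1 - J * Φ E - J ^ 2 / 2 * Φ E ^ 2| ≤ (|J| * c) ^ 3 := by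
    intro E
    have hx : |J * Φ E| ≤ |J| * c := by rw [abs_mul]; exact mul_le_mul_of_nonneg_left (hΦb E) (abs_nonneg _)
    have hx1 : |J * Φ E| ≤ 1 := hx.trans hJ
    have h := Literature.Barriers.CriticalPhenomena.HierarchicalRG.abs_exp_sub_le hx1
    have h2 : Real.exp (J * Φ E) - 1 - J * Φ E - J ^ 2 / 2 * Φ E ^ 2 =
        Real.exp (J * Φ E) - 1 - J * Φ E - (J * Φ E) ^ 2 / 2 := by ring
    rw [h2]
    exact h.trans (pow_le_pow_left₀ (abs_nonneg _) hx 3)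
  -- integrate
  rw [rectSliceKernelTw_eq_integral_exp]
  have heq : (∫ E, Real.exp (J * Φ E) ∂μE) - 1 - J * (∫ E, Φ E ∂μE) - J ^ 2 / 2 * (∫ E, Φ E ^ 2 ∂μE) =
      ∫ E, (Real.exp (J * Φ E) - 1 - J * Φ E - J ^ 2 / 2 * Φ E ^ 2) ∂μE := by
    have i1J : Integrable (fun E => J * Φ E) μE := i1.const_mul J
    have i2J : Integrable (fun E => J ^ 2 / 2 * Φ E ^ 2) μE := i2.const_mul _
    have ie1 : Integrable (fun E => Real.exp (J * Φ E) - 1) μE := iexp.sub (integrable_const _)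
    have ie1J : Integrable (fun E => Real.exp (J * Φ E) - 1 - J * Φ E) μE := ie1.sub i1J
    rw [integral_sub ie1J i2J, integral_sub ie1 i1J, integral_sub iexp (integrable_const _), integral_const_mul,
      integral_const_mul, integral_const, probReal_univ, one_smul]
  show |(∫ E, Real.exp (J * Φ E) ∂μE) - 1 - J * (∫ E, Φ E ∂μE) - J ^ 2 / 2 * (∫ E, Φ E ^ 2 ∂μE)| ≤ (|J| * c) ^ 3
  rw [heq]
  have h := norm_integral_le_of_norm_le_const (μ := μE)
    (f := fun E => Real.exp (J * Φ E) - 1 - J * Φ E - J ^ 2 / 2 * Φ E ^ 2) (C := (|J| * c) ^ 3)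
    (ae_of_all _ fun E => by rw [Real.norm_eq_abs]; exact hpt E)
  rwa [Real.norm_eq_abs, probReal_univ, mul_one] at h

/-- The real-arithmetic heart of the second-order law: from the second-order data
`t ≈ 1 + J m₁ + (J²/2) m₂`, `v ≈ J² V`, `N ≈ t + v` (all up to `O(u³)`, `u ≤ 1/8`) conclude
`|log N − (J m₁ + (J²/2)(m₂ − m₁²) + J² V)| ≤ 100 u³`. [folklore] -/
theorem abs_log_sub_secondOrder_le {u J m₁ m₂ V t v N : ℝ} (hu0 : 0 ≤ u) (hu : u ≤ 1 / 8)
    (h1 : |J * m₁| ≤ u) (h2 : |J ^ 2 / 2 * m₂| ≤ u ^ 2 / 2) (h3 : 0 ≤ J ^ 2 * V) (h3' : J ^ 2 * V ≤ 4 * u ^ 2)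
    (ht : |t - (1 + J * m₁ + J ^ 2 / 2 * m₂)| ≤ u ^ 3) (hv : |v - J ^ 2 * V| ≤ 6 * u ^ 3)
    (hN : |N - (t + v)| ≤ 32 * u ^ 3) :
    |Real.log N - (J * m₁ + J ^ 2 / 2 * (m₂ - m₁ ^ 2) + J ^ 2 * V)| ≤ 100 * u ^ 3 := by
  set x : ℝ := N - 1 with hx
  set A : ℝ := J * m₁ + J ^ 2 / 2 * m₂ + J ^ 2 * V with hA
  have hu2 : u ^ 2 ≤ u / 8 := by nlinarith
  have hu3 : u ^ 3 ≤ u ^ 2 / 8 := by nlinarith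
  -- `|x − A| ≤ 39 u³`
  have hxA : |x - A| ≤ 39 * u ^ 3 := by
    have e : x - A = (N - (t + v)) + (t - (1 + J * m₁ + J ^ 2 / 2 * m₂)) + (v - J ^ 2 * V) := by
      rw [hx, hA]; ring
    rw [e]
    calc |(N - (t + v)) + (t - (1 + J * m₁ + J ^ 2 / 2 * m₂)) + (v - J ^ 2 * V)|
        ≤ |N - (t + v)| + |t - (1 + J * m₁ + J ^ 2 / 2 * m₂)| + |v - J ^ 2 * V| :=
          (abs_add_le _ _).trans (add_le_add (abs_add_le _ _) le_rfl)
      _ ≤ 39 * u ^ 3 := by linarith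
  -- `|A| ≤ (13/8) u`, `|A − J m₁| ≤ (9/2) u²`
  have hAm : |A - J * m₁| ≤ 9 / 2 * u ^ 2 := by
    have e : A - J * m₁ = J ^ 2 / 2 * m₂ + J ^ 2 * V := by rw [hA]; ring
    rw [e]
    calc |J ^ 2 / 2 * m₂ + J ^ 2 * V| ≤ |J ^ 2 / 2 * m₂| + |J ^ 2 * V| := abs_add_le _ _
      _ ≤ u ^ 2 / 2 + 4 * u ^ 2 := add_le_add h2 (by rw [abs_of_nonneg h3]; exact h3')
      _ = 9 / 2 * u ^ 2 := by ring
  have hAb : |A| ≤ 13 / 8 * u := by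
    have e : A = J * m₁ + (A - J * m₁) := by ring
    rw [e]
    calc |J * m₁ + (A - J * m₁)| ≤ |J * m₁| + |A - J * m₁| := abs_add_le _ _
      _ ≤ u + 9 / 2 * u ^ 2 := add_le_add h1 hAm
      _ ≤ 13 / 8 * u := by nlinarith
  -- `|x| ≤ (9/4) u ≤ 1/2`
  have hxb : |x| ≤ 9 / 4 * u := by
    have e : x = A + (x - A) := by ring
    rw [e]
    calc |A + (x - A)| ≤ |A| + |x - A| := abs_add_le _ _
      _ ≤ 13 / 8 * u + 39 * u ^ 3 := add_le_add hAb hxA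
      _ ≤ 9 / 4 * u := by nlinarith
  have hx2 : |x| ≤ 1 / 2 := by linarith
  -- the logarithm
  have hlog : |Real.log (1 + x) - (x - x ^ 2 / 2)| ≤ 2 * |x| ^ 3 :=
    Literature.Barriers.AtomisticToContinuum.HeatConduction.abs_log_one_add_sub_le hx2
  have hN1 : N = 1 + x := by rw [hx]; ring
  have hx3 : |x| ^ 3 ≤ (9 / 4 * u) ^ 3 := pow_le_pow_left₀ (abs_nonneg _) hxb 3
  -- `|x² − (J m₁)²|/2 ≤ |x − J m₁| |x + J m₁| / 2`
  have hxm : |x - J * m₁| ≤ 39 * u ^ 3 + 9 / 2 * u ^ 2 := by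
    have e : x - J * m₁ = (x - A) + (A - J * m₁) := by ring
    rw [e]
    exact (abs_add_le _ _).trans (add_le_add hxA hAm)
  have hxp : |x + J * m₁| ≤ 9 / 4 * u + u := (abs_add_le _ _).trans (add_le_add hxb h1)
  have hsq : |x ^ 2 / 2 - (J * m₁) ^ 2 / 2| ≤ (39 * u ^ 3 + 9 / 2 * u ^ 2) * (9 / 4 * u + u) / 2 := by
    have e : x ^ 2 / 2 - (J * m₁) ^ 2 / 2 = (x - J * m₁) * (x + J * m₁) / 2 := by ring
    rw [e, abs_div, abs_mul, abs_two]
    exact div_le_div_of_nonneg_right (mul_le_mul hxm hxp (abs_nonneg _) (by positivity)) zero_le_two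
  -- assemble
  have e : Real.log N - (J * m₁ + J ^ 2 / 2 * (m₂ - m₁ ^ 2) + J ^ 2 * V) =
      (Real.log (1 + x) - (x - x ^ 2 / 2)) + (x - A) - (x ^ 2 / 2 - (J * m₁) ^ 2 / 2) := by
    rw [hN1, hA]; ring
  rw [e]
  calc |(Real.log (1 + x) - (x - x ^ 2 / 2)) + (x - A) - (x ^ 2 / 2 - (J * m₁) ^ 2 / 2)|
      ≤ |Real.log (1 + x) - (x - x ^ 2 / 2)| + |x - A| + |x ^ 2 / 2 - (J * m₁) ^ 2 / 2| :=
        (abs_sub _ _).trans (add_le_add (abs_add_le _ _) le_rfl)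
    _ ≤ 2 * (9 / 4 * u) ^ 3 + 39 * u ^ 3 + (39 * u ^ 3 + 9 / 2 * u ^ 2) * (9 / 4 * u + u) / 2 := by
        linarith [hlog, hx3, hxA, hsq]
    _ ≤ 100 * u ^ 3 := by nlinarith

end KernelTaylor

end Summit.Ventures.YMGap.FlowData
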